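import Summits.SmoothPoincare4.SmoothPoincare4.Theses.EntropyRung
import Literature.Geometry.Lorentzian.MassCapacityPotential
import Literature.Geometry.Lorentzian.CurvatureRegularity
import HarnessLib

/-!
# Green data force the ground state of `−Δ_g + R_g/6` to be positive
(stub `stub_conformalGroundStatePos`, line `green-blowup-conformal-entropy`, crux
`EntropyRung.SubcylindricalExistence`, item stmt-SmoothPoincare4-10871)

Stub C1 of the line. On a closed smooth homotopy 4-sphere `M` of the summit binder (model
`ℝ⁴ = EuclideanSpace ℝ (Fin 4)`, `I = 𝓡 4`) with a Riemannian metric `g` (Levi-Civita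
connection), let `(g, p, G)` be GREEN DATA: `G` smooth and positive on `M ∖ {p}`,
`R_g G − 6 Δ_g G = 0` there (`Δ_g = tr_g Hess`, the tree's `dalembertian`), and `G → +∞` at `p`.
Then every smooth positive solution `φ` of `−Δ_g φ + (R_g/6) φ = ev φ` has `ev > 0`.

Proof (E. Hopf's minimum principle; no conformal change and no product rule is needed).
Suppose `ev ≤ 0`. The quotient `G/φ` is continuous on `M ∖ {p}` and tends to `+∞` at `p`
(`φ ≤ max φ`), so it attains its infimum `t > 0` over `M ∖ {p}` at some `x₁ ≠ p` (the superlevel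
set near `p` is avoided, the rest is compact). Put `ψ := G − t φ ≥ 0` on `M ∖ {p}`, `ψ(x₁) = 0`.
On `M ∖ {p}`, by linearity of `Δ_g` (`dalembertian_sub`, `dalembertian_real_comp`),
`Δ_g ψ = (R/6) G − t ((R/6) φ − ev φ) = (R/6) ψ + t ev φ ≤ (R/6) ψ ≤ (R/6)⁺ ψ`.
Hopf's strong minimum principle on the connected component `C` of `x₁` in the open set `M ∖ {p}`
(`dalembertian_supersolution_eqOn_of_isPreconnected`, `MassCapacityPotential.lean`, with
`c = (R/6)⁺ ≥ 0`, `m = 0`) gives `ψ ≡ 0`, i.e. `G = t φ`, on `C`. But `M ≃ₕ S⁴` is connected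
(`pathConnectedSpace_of_homotopyEquiv`) and locally connected, so the open set `C ≠ M` is not
closed, and its closure inside `M` can only add the point `p`; hence `p ∈ closure C`, and along
`𝓝[C] p` the function `G = t φ` stays bounded while `G → +∞` — a contradiction.

References: J. M. Lee, T. H. Parker, *The Yamabe problem*, Bull. AMS 17 (1987), §2–3 and
Thm. 6.5 [LeeParker1987]; J. López-Gómez, *Linear Second Order Elliptic Operators* (2012),
Thm. 1.2 [LopezGomez2012]; D. Gilbarg, N. S. Trudinger (2001), Thm. 3.5 [GilbargTrudinger2001].
Everything is proved; no definition, no named fact.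
-/

noncomputable section

-- the registered namespace `Summit.SmoothPoincare4.SmoothPoincare4.Theorems` repeats a component
set_option linter.dupNamespace false

open scoped Manifold ContDiff Topology ENNReal NNReal ContinuousMap
open Set Filter MeasureTheory
open Literature.Geometry.Lorentzian Literature.Geometry.Riemannian

namespace Summit.SmoothPoincare4.SmoothPoincare4.Theorems

/-- A manifold modelled on `ℝ⁴` has no isolated point: the chart at `p` would map the open
singleton `{p}` onto an open singleton of `ℝ⁴`. [folklore] -/
private theorem conformalGroundStatePos_nhdsNE_neBot {M : Type*} [TopologicalSpace M]
    [ChartedSpace (EuclideanSpace ℝ (Fin 4)) M] (p : M) : (𝓝[≠] p).NeBot := by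
  refine ⟨fun h ↦ ?_⟩
  haveI : Nontrivial (EuclideanSpace ℝ (Fin 4)) :=
    Module.nontrivial_of_finrank_pos (R := ℝ) (by simp)
  have hopen : IsOpen ({p} : Set M) := (isOpen_singleton_iff_punctured_nhds p).2 h
  set c := chartAt (EuclideanSpace ℝ (Fin 4)) p
  have himg : IsOpen (c '' {p}) :=
    c.isOpen_image_of_subset_source hopen (singleton_subset_iff.2 (mem_chart_source _ p))
  rw [image_singleton] at himg
  exact (inferInstance : (𝓝[≠] (c p)).NeBot).ne ((isOpen_singleton_iff_punctured_nhds _).1 himg)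

/-- On a compact space, a function continuous off a non-isolated point `p` and tending to `+∞`
at `p` attains its infimum over `{p}ᶜ`. [folklore] -/
private theorem conformalGroundStatePos_exists_min {M : Type*} [TopologicalSpace M]
    [CompactSpace M] {p : M} [(𝓝[≠] p).NeBot] {w : M → ℝ} (hw : ContinuousOn w {p}ᶜ)
    (hlim : Tendsto w (𝓝[≠] p) atTop) : ∃ x₁, x₁ ≠ p ∧ ∀ x, x ≠ p → w x₁ ≤ w x := by
  obtain ⟨x₀, hx₀⟩ := Filter.nonempty_of_mem (self_mem_nhdsWithin : {p}ᶜ ∈ 𝓝[≠] p)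
  have hx₀p : x₀ ≠ p := hx₀
  have hev : ∀ᶠ x in 𝓝 p, x ∈ ({p}ᶜ : Set M) → w x₀ < w x :=
    eventually_nhdsWithin_iff.1 (hlim.eventually_gt_atTop (w x₀))
  obtain ⟨U, hU, hUo, hpU⟩ := eventually_nhds_iff.1 hev
  have hKc : IsCompact Uᶜ := hUo.isClosed_compl.isCompact
  have hx₀K : x₀ ∈ Uᶜ := fun h ↦ lt_irrefl _ (hU x₀ h hx₀p)
  have hKsub : Uᶜ ⊆ {p}ᶜ := by
    intro x hx hxp
    rw [mem_singleton_iff] at hxp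
    exact hx (hxp ▸ hpU)
  obtain ⟨x₁, hx₁K, hmin⟩ := hKc.exists_isMinOn ⟨x₀, hx₀K⟩ (hw.mono hKsub)
  refine ⟨x₁, hKsub hx₁K, fun x hx ↦ ?_⟩
  by_cases hxU : x ∈ U
  · exact (hmin hx₀K).trans (hU x hxU hx).le
  · exact hmin hxU

/-- In a connected, locally connected `T₁` space, the point `p` adheres to every connected
component of `{p}ᶜ` (otherwise that component would be a proper clopen subset). [folklore] -/
private theorem conformalGroundStatePos_mem_closure {M : Type*} [TopologicalSpace M]
    [T1Space M] [PreconnectedSpace M] [LocallyConnectedSpace M] {p x₁ : M} (hx₁ : x₁ ≠ p) :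
    p ∈ closure (connectedComponentIn {p}ᶜ x₁) := by
  by_contra hp
  set C := connectedComponentIn ({p}ᶜ : Set M) x₁ with hC
  have hx₁C : x₁ ∈ C := mem_connectedComponentIn hx₁
  have hcl : closure C ⊆ {p}ᶜ := by
    intro y hy hyp
    rw [mem_singleton_iff] at hyp
    exact hp (hyp ▸ hy)
  have hsub : closure C ⊆ C :=
    isPreconnected_connectedComponentIn.closure.subset_connectedComponentIn
      (subset_closure hx₁C) hcl
  have hclosed : IsClosed C := closure_subset_iff_isClosed.1 hsub
  have hopen : IsOpen C := isOpen_compl_singleton.connectedComponentIn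
  have huniv : C = univ := IsClopen.eq_univ ⟨hclosed, hopen⟩ ⟨x₁, hx₁C⟩
  have hpC : p ∈ C := huniv ▸ mem_univ p
  exact connectedComponentIn_subset _ _ hpC rfl

/-- **Stub C1 — Green data force the ground-state eigenvalue of `−Δ_g + R_g/6` to be positive**
(registered stub `stub_conformalGroundStatePos` of line `green-blowup-conformal-entropy`): on a
closed smooth homotopy 4-sphere with Riemannian `g`, if `G` is smooth and positive on `M ∖ {p}`
with `R_g G − 6 Δ_g G = 0` there and `G → +∞` at `p`, then every smooth positive `φ` with
`−Δ_g φ + (R_g/6) φ = ev φ` has `0 < ev`. If `ev ≤ 0`, the infimum `t` of `G/φ` over `M ∖ {p}` is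
attained at `x₁ ≠ p`, `ψ = G − tφ ≥ 0` vanishes at `x₁` and satisfies `Δ_g ψ ≤ (R/6)⁺ ψ` off `p`,
so E. Hopf's minimum principle makes `ψ ≡ 0` on the component of `x₁` in `M ∖ {p}`, whose closure
contains `p` (`M` connected) — impossible since `G → ∞` while `tφ` stays bounded. Lee–Parker 1987,
§2–3; the minimum principle is López-Gómez 2012, Thm. 1.2. [cite: LopezGomez2012, Thm. 1.2] -/
theorem stub_conformalGroundStatePos :
    ∀ (M : Type) [TopologicalSpace M] [T2Space M] [SecondCountableTopology M]
      [ChartedSpace (EuclideanSpace ℝ (Fin 4)) M] [IsManifold (𝓡 4) ∞ M] [CompactSpace M]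
      [T3Space M] [MeasurableSpace M] [BorelSpace M],
      M ≃ₕ Metric.sphere (0 : EuclideanSpace ℝ (Fin 5)) 1 →
      ∀ (g : PseudoRiemannianMetric (𝓡 4) ∞ (EuclideanSpace ℝ (Fin 4)) (TangentSpace (𝓡 4) : M → Type _))
        [g.HasLeviCivita], g.IsRiemannian → ∀ (p : M) (G : M → ℝ),
        (ContMDiffOn (𝓡 4) 𝓘(ℝ, ℝ) ∞ G {p}ᶜ ∧ (∀ x, x ≠ p → 0 < G x) ∧
          (∀ x, x ≠ p → g.scalarCurvature x * G x - 6 * g.dalembertian G x = 0) ∧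
          Tendsto G (𝓝[≠] p) atTop) →
        ∀ (φ : M → ℝ) (ev : ℝ), ContMDiff (𝓡 4) 𝓘(ℝ, ℝ) ∞ φ → (∀ x, 0 < φ x) →
          (∀ x, -g.dalembertian φ x + g.scalarCurvature x / 6 * φ x = ev * φ x) → 0 < ev := by
  intro M _ _ _ _ _ _ _ _ _ e g _ hg p G hGreen φ ev hφ hφpos hpde
  obtain ⟨hGs, hGpos, hGpde, hGlim⟩ := hGreen
  -- `M ≃ₕ S⁴` is connected; a manifold is locally connected; `p` is not isolated
  haveI : PathConnectedSpace (Metric.sphere (0 : EuclideanSpace ℝ (Fin 5)) 1) :=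
    Literature.Topology.FourManifolds.pathConnectedSpace_sphere_four
  haveI : PathConnectedSpace M :=
    Literature.Topology.FourManifolds.pathConnectedSpace_of_homotopyEquiv e
  haveI : LocallyConnectedSpace M :=
    ChartedSpace.locallyConnectedSpace (EuclideanSpace ℝ (Fin 4)) M
  haveI : (𝓝[≠] p).NeBot := conformalGroundStatePos_nhdsNE_neBot p
  by_contra hev'
  have hev : ev ≤ 0 := not_lt.1 hev'
  -- the quotient `G/φ` tends to `+∞` at `p` and attains its infimum `t` over `{p}ᶜ` at `x₁`
  have hφc : Continuous φ := hφ.continuous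
  obtain ⟨xM, -, hxM⟩ := isCompact_univ.exists_isMaxOn univ_nonempty hφc.continuousOn
  have hle : ∀ x, φ x ≤ φ xM := fun x ↦ hxM (mem_univ x)
  have hwlim : Tendsto (fun x ↦ G x / φ x) (𝓝[≠] p) atTop := by
    refine tendsto_atTop_mono' _ ?_ (hGlim.atTop_div_const (hφpos xM))
    filter_upwards [self_mem_nhdsWithin] with x hx
    exact div_le_div_of_nonneg_left (hGpos x hx).le (hφpos x) (hle x)
  have hwc : ContinuousOn (fun x ↦ G x / φ x) {p}ᶜ :=
    hGs.continuousOn.div hφc.continuousOn fun x _ ↦ (hφpos x).ne'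
  obtain ⟨x₁, hx₁, hmin⟩ := conformalGroundStatePos_exists_min hwc hwlim
  set t : ℝ := G x₁ / φ x₁ with ht
  have htpos : 0 < t := div_pos (hGpos x₁ hx₁) (hφpos x₁)
  -- `ψ = G − t φ ≥ 0` off `p`, `ψ x₁ = 0`
  set ψ : M → ℝ := fun x ↦ G x - t * φ x with hψ
  have hψnn : ∀ x, x ≠ p → 0 ≤ ψ x := fun x hx ↦ by
    have h2 : t * φ x ≤ G x := (le_div_iff₀ (hφpos x)).1 (hmin x hx)
    simp only [hψ]
    linarith
  have hψx₁ : ψ x₁ = 0 := by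
    simp only [hψ, ht]
    rw [div_mul_cancel₀ _ (hφpos x₁).ne']
    ring
  -- `Δ_g ψ ≤ (R/6)⁺ ψ` off `p`
  set c : M → ℝ := fun x ↦ max (g.scalarCurvature x / 6) 0 with hc
  have hcc : Continuous c :=
    (g.contMDiff_scalarCurvature.continuous.div_const 6).max continuous_const
  have hc0 : ∀ x, 0 ≤ c x := fun x ↦ le_max_right _ _
  have h2le : (2 : ℕ∞ω) ≤ ((⊤ : ℕ∞) : ℕ∞ω) := WithTop.coe_le_coe.mpr le_top
  have hψpde : ∀ x, x ≠ p → g.dalembertian ψ x ≤ c x * ψ x := by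
    intro x hx
    have hGx : ContMDiffAt (𝓡 4) 𝓘(ℝ, ℝ) 2 G x :=
      (hGs.of_le h2le).contMDiffAt (isOpen_compl_singleton.mem_nhds hx)
    have hφx : ContMDiffAt (𝓡 4) 𝓘(ℝ, ℝ) 2 φ x := (hφ.of_le h2le).contMDiffAt
    have htφx : ContMDiffAt (𝓡 4) 𝓘(ℝ, ℝ) 2 (fun y ↦ t * φ y) x := contMDiffAt_const.mul hφx
    have h1 : g.dalembertian ψ x = g.dalembertian G x - g.dalembertian (fun y ↦ t * φ y) x :=
      dalembertian_sub g hGx htφx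
    have h2 : g.dalembertian (fun y ↦ t * φ y) x = t * g.dalembertian φ x := by
      have hζ : ContDiffAt ℝ 2 (fun s : ℝ ↦ t * s) (φ x) :=
        (contDiff_const.mul contDiff_id).contDiffAt
      have hd : deriv (fun s : ℝ ↦ t * s) = fun _ ↦ t := by
        funext s
        have : HasDerivAt (fun s : ℝ ↦ t * s) t s := by
          simpa using (hasDerivAt_id s).const_mul t
        exact this.deriv
      have hdd : deriv (deriv (fun s : ℝ ↦ t * s)) = fun _ ↦ 0 := by
        rw [hd]
        funext s
        exact deriv_const s t
      have key := g.dalembertian_real_comp hφx hζ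
      rw [hdd, hd] at key
      rw [show (fun y ↦ t * φ y) = (fun s : ℝ ↦ t * s) ∘ φ from rfl, key]
      ring
    have hG' : g.dalembertian G x = g.scalarCurvature x * G x / 6 := by
      have := hGpde x hx
      linarith
    have hφ' : g.dalembertian φ x = g.scalarCurvature x / 6 * φ x - ev * φ x := by
      have := hpde x
      linarith
    have hR : g.scalarCurvature x / 6 * ψ x ≤ c x * ψ x :=
      mul_le_mul_of_nonneg_right (le_max_left _ _) (hψnn x hx)
    have hneg : t * (ev * φ x) ≤ 0 :=
      mul_nonpos_of_nonneg_of_nonpos htpos.le (mul_nonpos_of_nonpos_of_nonneg hev (hφpos x).le)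
    rw [h1, h2, hG', hφ']
    simp only [hψ] at hR ⊢
    linarith
  -- Hopf's strong minimum principle on the component `C` of `x₁` in `{p}ᶜ`: `ψ ≡ 0` on `C`
  set C : Set M := connectedComponentIn {p}ᶜ x₁ with hC
  have hCo : IsOpen C := isOpen_compl_singleton.connectedComponentIn
  have hCsub : C ⊆ {p}ᶜ := connectedComponentIn_subset _ _
  have hx₁C : x₁ ∈ C := mem_connectedComponentIn hx₁
  have hψ2 : ContMDiffOn (𝓡 4) 𝓘(ℝ, ℝ) 2 ψ C :=
    ((hGs.of_le h2le).mono hCsub).sub ((contMDiff_const.mul hφ).of_le h2le).contMDiffOn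
  have key := g.dalembertian_supersolution_eqOn_of_isPreconnected hg (V := ⟨C, hCo⟩)
    isPreconnected_connectedComponentIn hcc.continuousOn (fun x _ ↦ hc0 x) hψ2
    (fun x hx ↦ hψpde x (hCsub hx)) le_rfl (fun x hx ↦ hψnn x (hCsub hx)) hx₁C hψx₁
  -- `p ∈ closure C`, and along `𝓝[C] p` we have `G = t φ → t φ(p)` but `G → +∞`
  have hpC : p ∈ closure C := conformalGroundStatePos_mem_closure hx₁
  haveI : (𝓝[C] p).NeBot := mem_closure_iff_nhdsWithin_neBot.1 hpC
  have hGC : Tendsto G (𝓝[C] p) atTop := hGlim.mono_left (nhdsWithin_mono p hCsub)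
  have hE1 : ∀ᶠ x in 𝓝[C] p, t * φ p + 1 < G x := hGC.eventually_gt_atTop _
  have hE2 : ∀ᶠ x in 𝓝[C] p, G x = t * φ x := by
    filter_upwards [self_mem_nhdsWithin] with x hx
    have h0 : ψ x = 0 := key x hx
    simp only [hψ] at h0
    linarith
  have hE3 : ∀ᶠ x in 𝓝[C] p, t * φ x < t * φ p + 1 := by
    have hct : ContinuousAt (fun x ↦ t * φ x) p := (continuous_const.mul hφc).continuousAt
    have h : ∀ᶠ x in 𝓝 p, t * φ x < t * φ p + 1 :=
      hct.eventually (eventually_lt_nhds (lt_add_one _))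
    exact h.filter_mono nhdsWithin_le_nhds
  obtain ⟨x, hx1, hx2, hx3⟩ := (hE1.and (hE2.and hE3)).exists
  linarith

end Summit.SmoothPoincare4.SmoothPoincare4.Theorems

end
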